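import Literature.NumberTheory.LFunctions.SiegelTatuzawaHoffsteinTripleCoefficients
import Literature.NumberTheory.LFunctions.SiegelTatuzawaHoffsteinLemma
import HarnessLib

/-!
# Hoffstein's §3 core for three real characters: the smoothed Perron integral of
# `ζ(s)L(s,χ)L(s,χ′)L(s,ψ)`, the contour shift to `Re(s+β) = −½`, and the master inequality
# `c (1−β) ≤ L(1,χ)L(1,χ′)L(1,ψ) x^{1−β}` (Acta Arith. 38 (1980), (7)–(11), pp. 171–172)

Topic `Literature/NumberTheory/LFunctions`, namespace `Literature.NumberTheory.LFunctions.Hoffstein1980`.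
Everything in this file is PROVED (no named fact). It is the analytic section of the discharge of the
tree's named fact `hoffstein1980_theorem1'` (`SiegelTatuzawaExplicit.lean`), following §3 of
J. Hoffstein, *On the Siegel–Tatuzawa theorem*, Acta Arith. **38** (1980) 167–174:

> "Let `K, D_K, ζ_K(s)` be as in Lemma 3 and let `a = −3/2 − β′` and `x = |D_K|^A`, `A > .8`. Using the
> functional equation for `ζ_K(s)` we can show as in Lemma 1 that
> (7) `|9!/(2πi) ∫_{a−i∞}^{a+i∞} ζ_K(s+β′)x^s ds/(s∏_{n=1}^{9}(s+n))| ≤ .099/|D_K|^{A(3/2+β′)−2}` …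
> it follows that `I = (1/2πi)∫_{2−i∞}^{2+i∞} … = (1/9!) Σ_{N𝔞<x} (N𝔞)^{−β′}(1 − N𝔞/x)⁹` … For every
> integer `n`, `n⁴` is the norm of an ideal, so (9) `9! I ≥ Σ_{n=1}^{5} n^{−4}(1 − n⁴/x)⁹ ≥ 1.080`.
> Moving the line of integration to `Re s = a`, (10) `I = (1/2πi)∫_{(a)} … +
> L(1,χ)L(1,χ′)L(1,χχ′)x^{1−β′}/((1−β′)∏(n+1−β′)) + ζ_K(β′)/9! − ζ_K(−1+β′)x^{−1}/8! +
> ζ_K(−2+β′)x^{−2}/(2·7!)`. But `ζ_K(β′) = 0` and `−ζ_K(−1+β′) < 0`, so … (11)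
> `0.981(1 − β′) ≤ L(1,χ)L(1,χ′)L(1,χχ′)x^{1−β′}`." (pp. 171–172)

Here `F(s) = ζ(s)L(s,χ)L(s,χ′)L(s,ψ)` (`hoffF`) for three primitive quadratic characters
(`ψ` the primitive character inducing `χχ′`, cf. `exists_primitive_inducer`), with the coefficient
facts of `SiegelTatuzawaHoffsteinTripleCoefficients.lean` (`a ≥ 0`, `a(m²) ≥ 1`) in place of ideal
counting. DEVIATIONS FROM THE PRINTED ROUTE (recorded): (i) we keep the degree-6 kernel
`K(s) = 1/(s(s+2)⋯(s+6))` of Lemma 1 (`hoffKernel`) and move the line only to `Re(s+β) = −½`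
(`a = −½ − β`), so that the only poles crossed are `s = 1 − β` (pole of `ζ`) and `s = 0` (where the
residue `F(β)/6!` VANISHES when `L(β,χ′) = 0`) — no sign information on `ζ_K(β′−1), ζ_K(β′−2)` is
needed; (ii) on the left line we use Rademacher's explicit reflection bound
`|L(−½+it, χ)| ≤ (k/2π)|½+it| ζ(3/2)` (`Rademacher1959.norm_LFunction_le_of_re_eq_neg`, Math. Z. 72
(1959) (6.2)) for each of the three characters and `|ζ(−½+it)| = (1/2π)|½+it||ζ(3/2−it)|`
(`norm_riemannZeta_neg_half`), against `(¼+t²)²|K(a+it)| ≤ 1/(49/4+t²)` (`left_kernel_bound3`); the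
horizontal sides vanish since `|F| ≪ |t|⁵` in the strip (Rademacher's Theorem 3 for the three `L`,
`|ζ| ≪ t²`) against `|K| ≤ |t|^{−6}`; (iii) squares instead of fourth powers in (9), giving
`6!·I ≥ Σ_{m≤200}(m^{−2} − 15m²/x²)` (`squares_lower_bound3`) as in the tree's Lemma 1 file.
Result (`hoffstein_master3`): for `x ≥ 40000`, `½ < β < 1` with `F(β) = 0`,
`(1−β)·(x^{−(1−β)} Σ_{m≤200}(1/m² − 15m²/x²) − C₃ x^{−3/2}) ≤ L(1,χ)L(1,χ′)L(1,ψ)` with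
`C₃ = 720·(qq′k)·ζ(3/2)⁴/(7(2π)⁴)` (`hoffErr3`) — the three-character analogue of the tree's
`Hoffstein1980.hoffstein_master` (file `SiegelTatuzawaHoffsteinLemma.lean`), whose architecture
(contour identity `integral_vertical_sub_eq_sum_of_simplePoles`, smoothed Perron formula
`integral_LSeries_mul_hoffKernel_eq`) is followed line by line.

## References

* J. Hoffstein, On the Siegel–Tatuzawa theorem, Acta Arith. 38 (1980) 167–174, §3 (7)–(11),
  pp. 171–172. [Hoffstein1980SiegelTatuzawa]
* H. Rademacher, On the Phragmén–Lindelöf theorem and some applications, Math. Z. 72 (1959)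
  192–204, (6.2) and Theorem 3 (tree: `RademacherDirichletLConvexity.lean`). [Rademacher1959]
-/

noncomputable section

open Complex Set MeasureTheory Filter Topology DirichletCharacter
open scoped Real

namespace Literature.NumberTheory.LFunctions.Hoffstein1980

open Literature.NumberTheory.LFunctions.Booker2006Turing Literature.Analysis.Complex

section Triple

variable {q q' k : ℕ} [NeZero q] [NeZero q'] [NeZero k]
variable {χ : DirichletCharacter ℂ q} {χ' : DirichletCharacter ℂ q'} {ψ : DirichletCharacter ℂ k}

/-! ### The product `F = ζ·L_χ·L_χ′·L_ψ` and the integrand -/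

/-- `F(s) = ζ(s)L(s,χ)L(s,χ′)L(s,ψ)` ("`ζ_K(s) = ζ(s)L(s,χ)L(s,χ′)L(s,χχ′)`", `K = ℚ(√d,√d′)`).
[cite: Hoffstein1980SiegelTatuzawa, §3 proof of Lemma 3 p. 170] -/
def hoffF (χ : DirichletCharacter ℂ q) (χ' : DirichletCharacter ℂ q') (ψ : DirichletCharacter ℂ k)
    (s : ℂ) : ℂ :=
  zetaL χ s * (χ'.LFunction s * ψ.LFunction s)

/-- The integrand `G(s) = F(s + β) x^s K(s)` of (7)/(10), with the degree-6 kernel of Lemma 1.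
[cite: Hoffstein1980SiegelTatuzawa, §3 (7) p. 171] -/
def hoffG3 (χ : DirichletCharacter ℂ q) (χ' : DirichletCharacter ℂ q') (ψ : DirichletCharacter ℂ k)
    (β x : ℝ) (w : ℂ) : ℂ :=
  hoffF χ χ' ψ (w + β) * (x : ℂ) ^ w * hoffKernel w

omit [NeZero q] [NeZero q'] [NeZero k] in
/-- A primitive character modulo `n > 1` is non-trivial. [folklore] -/
private lemma ne_one_of_isPrimitive₃ {n : ℕ} [NeZero n] {φ : DirichletCharacter ℂ n}
    (hφ : φ.IsPrimitive) (hn : 1 < n) : φ ≠ 1 := by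
  rintro rfl
  have h : (1 : DirichletCharacter ℂ n).conductor = n := hφ
  rw [DirichletCharacter.conductor_one] at h; omega

/-- **`F(s) = Σ a(n) n^{-s}` for `Re s > 1`**, `a = tripleMul χ χ′ ψ` ("for `Re s > 1`, `ζ_K(s) = Σ (N𝔞)^{-s}`").
[cite: Hoffstein1980SiegelTatuzawa, §3 p. 171] -/
theorem hoffF_eq_LSeries (χ : DirichletCharacter ℂ q) (χ' : DirichletCharacter ℂ q')
    (ψ : DirichletCharacter ℂ k) {s : ℂ} (hs : 1 < s.re) :
    hoffF χ χ' ψ s = LSeries (tripleMul χ χ' ψ ·) s := by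
  rw [LSeries_tripleMul_eq χ χ' ψ hs, hoffF, zetaL]

/-- `F` is holomorphic off `s = 1` (for non-trivial characters). [cite: Hoffstein1980SiegelTatuzawa, §3 p. 171] -/
theorem differentiableAt_hoffF (hχ : χ ≠ 1) (hχ' : χ' ≠ 1) (hψ : ψ ≠ 1) {s : ℂ} (hs : s ≠ 1) :
    DifferentiableAt ℂ (hoffF χ χ' ψ) s :=
  (differentiableAt_zetaL hχ hs).mul
    ((differentiable_LFunction hχ' s).mul (differentiable_LFunction hψ s))

/-- The simple pole at `s = 1`: `F(s) = φ(s)/(s−1)` with the entire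
`φ = zetaReg1 · L_χ · (L_χ′ · L_ψ)`, `φ(1) = L(1,χ)L(1,χ′)L(1,ψ)`. [cite: Hoffstein1980SiegelTatuzawa, §3 (10) p. 171] -/
theorem hoffF_eq_div_of_ne_one (χ : DirichletCharacter ℂ q) (χ' : DirichletCharacter ℂ q')
    (ψ : DirichletCharacter ℂ k) {s : ℂ} (hs : s ≠ 1) :
    hoffF χ χ' ψ s = zetaReg1 s * χ.LFunction s * (χ'.LFunction s * ψ.LFunction s) / (s - 1) := by
  rw [hoffF, zetaL_eq_div_of_ne_one χ hs]
  field_simp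

/-- `F(β) = 0` at a zero `β` of `L(·, χ′)`. [cite: Hoffstein1980SiegelTatuzawa, §3 p. 171 ("`ζ_K(β′) = 0`")] -/
theorem hoffF_eq_zero_of_LFunction_eq_zero {s : ℂ} (hz : χ'.LFunction s = 0) : hoffF χ χ' ψ s = 0 := by
  rw [hoffF, hz, zero_mul, mul_zero]

/-! ### The left line `Re s = −½`: the reflection bounds -/

/-- **`|ζ(−½ + it)| = (1/π)|−¼ + it/2| · |ζ(3/2 − it)|`** (functional equation `Λ(s) = Λ(1−s)` and
`Γ(1 + z̄) = z̄Γ(z̄)`, `|Γ(z̄)| = |Γ(z)|` for `z = s/2 = −¼ + it/2`): the `ζ`-factor of the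
reflection step "using the functional equation for `ζ_K(s)`" at our line `Re s = −½`.
[cite: Hoffstein1980SiegelTatuzawa, §3 (7) p. 171] -/
theorem norm_riemannZeta_neg_half (t : ℝ) :
    ‖riemannZeta (-1 / 2 + t * I)‖ =
      ‖((-1 / 4 : ℝ) : ℂ) + t / 2 * I‖ * π ^ (-1 : ℝ) * ‖riemannZeta (3 / 2 - t * I)‖ := by
  set s : ℂ := -1 / 2 + t * I with hs
  set z : ℂ := ((-1 / 4 : ℝ) : ℂ) + t / 2 * I with hz
  have hs0 : s ≠ 0 := fun h ↦ by have := congrArg Complex.re h; simp [hs] at this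
  have h1s : (1 : ℂ) - s = 3 / 2 - t * I := by rw [hs]; ring
  have h1s0 : (1 : ℂ) - s ≠ 0 := fun h ↦ by
    have := congrArg Complex.re h; simp [hs] at this; norm_num at this
  have hre1 : 0 < ((1 : ℂ) - s).re := by simp [hs]; norm_num
  have hΓ1 : Gammaℝ (1 - s) ≠ 0 := Complex.Gammaℝ_ne_zero_of_re_pos hre1
  -- `ζ(s) = ζ(1-s) Γℝ(1-s) / Γℝ(s)`
  have hζ : riemannZeta s = riemannZeta (1 - s) * Gammaℝ (1 - s) / Gammaℝ s := by
    rw [riemannZeta_def_of_ne_zero hs0, ← completedRiemannZeta_one_sub, riemannZeta_def_of_ne_zero h1s0]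
    field_simp
  have hz2 : s / 2 = z := by rw [hs, hz]; push_cast; ring
  have hconj : (starRingEnd ℂ) z = ((-1 / 4 : ℝ) : ℂ) - t / 2 * I := by
    apply Complex.ext
    · rw [Complex.conj_re, hz]; simp
    · rw [Complex.conj_im, hz]; simp
  have hz1 : (1 - s) / 2 = (starRingEnd ℂ) z + 1 := by
    rw [hconj, hs]; push_cast; ring
  have hz0 : z ≠ 0 := fun h ↦ by have := congrArg Complex.re h; simp [hz] at this
  have hzc0 : (starRingEnd ℂ) z ≠ 0 := (map_ne_zero _).2 hz0
  have hΓz : Gamma z ≠ 0 := by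
    refine Complex.Gamma_ne_zero fun m hm ↦ ?_
    have := congrArg Complex.re hm
    simp [hz] at this
    have h4 : (4 : ℝ) * m = 1 := by linarith
    have h3 : 4 ∣ (1 : ℕ) := ⟨m, by exact_mod_cast h4.symm⟩
    omega
  have hquot : Gammaℝ (1 - s) / Gammaℝ s = (π : ℂ) ^ (s - 1 / 2) * ((starRingEnd ℂ) z * Gamma ((starRingEnd ℂ) z) / Gamma z) := by
    rw [Complex.Gammaℝ_def, Complex.Gammaℝ_def, hz1, hz2, Complex.Gamma_add_one _ hzc0]
    have hπ : (π : ℂ) ≠ 0 := ofReal_ne_zero.2 Real.pi_ne_zero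
    rw [show -(1 - s) / 2 = (s - 1 / 2) + (-s / 2) by ring, cpow_add _ _ hπ]
    have hπs : (π : ℂ) ^ (-s / 2) ≠ 0 := cpow_ne_zero_iff_of_exponent_ne_zero (by
      intro h; apply hs0; linear_combination (-2) * h) |>.2 hπ
    field_simp
  rw [hζ, mul_div_assoc, hquot, h1s]
  rw [norm_mul, norm_mul, norm_div, norm_mul, Complex.Gamma_conj, Complex.norm_conj, Complex.norm_conj,
    Complex.norm_cpow_eq_rpow_re_of_pos Real.pi_pos]
  have hre : (s - 1 / 2).re = -1 := by simp [hs]; norm_num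
  rw [hre]
  have hΓn : ‖Gamma z‖ ≠ 0 := norm_ne_zero_iff.2 hΓz
  field_simp

/-- `‖c + iy‖² = c² + y²` for real `c, y`. [folklore] -/
private lemma norm_sq_ofReal_add_mul_I' (c y : ℝ) : ‖(c : ℂ) + y * I‖ ^ 2 = c ^ 2 + y ^ 2 := by
  rw [Complex.sq_norm, Complex.normSq_apply]; simp; ring

/-- From `u² ≤ v²` with `v ≥ 0` to `u ≤ v`. [folklore] -/
private lemma le_of_sq_le_sq₃ {u v : ℝ} (hv : 0 ≤ v) (h : u ^ 2 ≤ v ^ 2) : u ≤ v := by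
  by_contra hlt
  push Not at hlt
  have hu : 0 ≤ u := hv.trans hlt.le
  nlinarith

/-- `‖½ + it‖ = √(¼ + t²)` and `‖−¼ + it/2‖ = ½√(¼ + t²)`: the two sizes on the line. [folklore] -/
private lemma norm_half_line (t : ℝ) :
    ‖(1 : ℂ) + (-1 / 2 + t * I)‖ = Real.sqrt (1 / 4 + t ^ 2) ∧
      ‖((-1 / 4 : ℝ) : ℂ) + t / 2 * I‖ = Real.sqrt (1 / 4 + t ^ 2) / 2 := by
  constructor
  · have e : (1 : ℂ) + (-1 / 2 + t * I) = ((1 / 2 : ℝ) : ℂ) + t * I := by push_cast; ring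
    rw [e, ← Real.sqrt_sq (norm_nonneg _), norm_sq_ofReal_add_mul_I']
    norm_num
  · have e : ((-1 / 4 : ℝ) : ℂ) + t / 2 * I = ((-1 / 4 : ℝ) : ℂ) + ((t / 2 : ℝ) : ℂ) * I := by push_cast; ring
    rw [e, ← Real.sqrt_sq (norm_nonneg _), norm_sq_ofReal_add_mul_I']
    rw [show ((-1 / 4 : ℝ)) ^ 2 + (t / 2) ^ 2 = (1 / 4 + t ^ 2) / 4 by ring,
      Real.sqrt_div' _ (by norm_num : (0:ℝ) ≤ 4), show Real.sqrt 4 = 2 by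
        rw [show (4:ℝ) = 2 ^ 2 by norm_num, Real.sqrt_sq (by norm_num)]]

/-- **`|ζ(−½ + it)| ≤ (1/2π) √(¼+t²) ζ(3/2)`.** [cite: Hoffstein1980SiegelTatuzawa, §3 (7) p. 171] -/
theorem norm_riemannZeta_neg_half_le (t : ℝ) :
    ‖riemannZeta (-1 / 2 + t * I)‖ ≤ 1 / (2 * π) * Real.sqrt (1 / 4 + t ^ 2) * bigZ (3 / 2) := by
  rw [norm_riemannZeta_neg_half t, (norm_half_line t).2]
  have hζ : ‖riemannZeta (3 / 2 - t * I)‖ ≤ bigZ (3 / 2) := by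
    have h := norm_riemannZeta_le_bigZ (σ := 3 / 2) (by norm_num) (-t)
    have e : ((3 / 2 : ℝ) : ℂ) + ((-t : ℝ) : ℂ) * I = 3 / 2 - t * I := by push_cast; ring
    rwa [e] at h
  have hπ := Real.pi_pos
  have hpi : (π : ℝ) ^ (-1 : ℝ) = 1 / π := by rw [Real.rpow_neg_one]; rw [one_div]
  rw [hpi]
  have h0 : 0 ≤ Real.sqrt (1 / 4 + t ^ 2) / 2 * (1 / π) := by positivity
  calc Real.sqrt (1 / 4 + t ^ 2) / 2 * (1 / π) * ‖riemannZeta (3 / 2 - t * I)‖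
      ≤ Real.sqrt (1 / 4 + t ^ 2) / 2 * (1 / π) * bigZ (3 / 2) := by gcongr
    _ = 1 / (2 * π) * Real.sqrt (1 / 4 + t ^ 2) * bigZ (3 / 2) := by ring

omit [NeZero q'] [NeZero k] in
/-- **`|L(−½ + it, χ)| ≤ (q/2π) √(¼+t²) ζ(3/2)`** for a primitive `χ` mod `q > 1` — Rademacher's (6.2)
with `η = ½`. [cite: Rademacher1959, (6.2)] -/
theorem norm_LFunction_neg_half_le (hq : 1 < q) (hχ : χ.IsPrimitive) (t : ℝ) :
    ‖χ.LFunction (-1 / 2 + t * I)‖ ≤ (q : ℝ) / (2 * π) * Real.sqrt (1 / 4 + t ^ 2) * bigZ (3 / 2) := by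
  have h := Rademacher1959.norm_LFunction_le_of_re_eq_neg hq hχ (η := 1 / 2) (by norm_num) le_rfl
    (s := -1 / 2 + t * I) (by simp; norm_num)
  rw [(norm_half_line t).1] at h
  have e1 : ((q : ℝ) / (2 * π)) ^ ((1 / 2 : ℝ) + 1 / 2) = (q : ℝ) / (2 * π) := by norm_num
  have e2 : Real.sqrt (1 / 4 + t ^ 2) ^ ((1 / 2 : ℝ) + 1 / 2) = Real.sqrt (1 / 4 + t ^ 2) := by norm_num
  have e3 : (riemannZeta (1 + (1 / 2 : ℝ))).re = bigZ (3 / 2) := by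
    have e : (1 : ℂ) + ((1 / 2 : ℝ) : ℂ) = ((3 / 2 : ℝ) : ℂ) := by push_cast; ring
    rw [e, bigZ]
  rw [e1, e2, e3] at h
  exact h

/-- The size of `F` on the left line: `C_F = (q q′ k) ζ(3/2)⁴/(2π)⁴`. [cite: Hoffstein1980SiegelTatuzawa, §3 (7) p. 171] -/
def leftConst3 (q q' k : ℕ) : ℝ := (q : ℝ) * q' * k * bigZ (3 / 2) ^ 4 / (2 * π) ^ 4

/-- **The left line, `F`-factor**: for primitive `χ, χ′, ψ` modulo `q, q′, k > 1`,
`‖F(−½ + it)‖ ≤ C_F · (¼ + t²)²`. [cite: Hoffstein1980SiegelTatuzawa, §3 (7) p. 171] -/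
theorem norm_hoffF_neg_half_le (hq : 1 < q) (hq' : 1 < q') (hk : 1 < k) (hχ : χ.IsPrimitive)
    (hχ' : χ'.IsPrimitive) (hψ : ψ.IsPrimitive) (t : ℝ) :
    ‖hoffF χ χ' ψ (-1 / 2 + t * I)‖ ≤ leftConst3 q q' k * (1 / 4 + t ^ 2) ^ 2 := by
  have hP : 0 ≤ 1 / 4 + t ^ 2 := by positivity
  set R : ℝ := Real.sqrt (1 / 4 + t ^ 2) with hR
  have hR0 : 0 ≤ R := Real.sqrt_nonneg _
  have hR4 : R ^ 4 = (1 / 4 + t ^ 2) ^ 2 := by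
    rw [show R ^ 4 = (R ^ 2) ^ 2 by ring, hR, Real.sq_sqrt hP]
  have hZ : 0 ≤ bigZ (3 / 2) := (bigZ_pos (by norm_num)).le
  have hπ := Real.pi_pos
  have h0 := norm_riemannZeta_neg_half_le t
  have h1 := norm_LFunction_neg_half_le hq hχ t
  have h2 := norm_LFunction_neg_half_le (χ := χ') hq' hχ' t
  have h3 := norm_LFunction_neg_half_le (χ := ψ) hk hψ t
  rw [← hR] at h0 h1 h2 h3
  unfold hoffF zetaL
  rw [norm_mul, norm_mul, norm_mul]
  calc ‖riemannZeta (-1 / 2 + t * I)‖ * ‖χ.LFunction (-1 / 2 + t * I)‖ *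
        (‖χ'.LFunction (-1 / 2 + t * I)‖ * ‖ψ.LFunction (-1 / 2 + t * I)‖)
      ≤ (1 / (2 * π) * R * bigZ (3 / 2)) * ((q : ℝ) / (2 * π) * R * bigZ (3 / 2)) *
          (((q' : ℝ) / (2 * π) * R * bigZ (3 / 2)) * ((k : ℝ) / (2 * π) * R * bigZ (3 / 2))) := by
        gcongr
    _ = leftConst3 q q' k * R ^ 4 := by unfold leftConst3; field_simp
    _ = leftConst3 q q' k * (1 / 4 + t ^ 2) ^ 2 := by rw [hR4]

/-- Positivity of `‖c + iy‖` for `c ≠ 0`. [folklore] -/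
private lemma norm_line_pos₃ {c : ℝ} (hc : c ≠ 0) (y : ℝ) : 0 < ‖(c : ℂ) + y * I‖ := by
  refine norm_pos_iff.2 fun h ↦ hc ?_
  have := congrArg Complex.re h; simpa using this

/-- `N ≤ P Q` from `N ≤ P²`, `N ≤ Q²` (`N, P, Q ≥ 0`). [folklore] -/
private lemma le_mul_of_le_sq₃ {N P Q : ℝ} (hN : 0 ≤ N) (hP : 0 ≤ P) (hQ : 0 ≤ Q) (h1 : N ≤ P ^ 2)
    (h2 : N ≤ Q ^ 2) : N ≤ P * Q :=
  le_of_sq_le_sq₃ (mul_nonneg hP hQ) (by rw [mul_pow, sq]; exact mul_le_mul h1 h2 hN (by positivity))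

/-- **The kernel on the left line** `Re s = a = −3/2 + κ` (`κ = 1 − β ∈ [0, ½)`):
`(¼ + y²)² ‖K(a + iy)‖ ≤ 1/(49/4 + y²)` (pair the six linear factors as `|s||s+2| ≥ ¼+y²`,
`|s+3||s+4| ≥ ¼+y²`, `|s+5||s+6| ≥ 49/4+y²`). [cite: Hoffstein1980SiegelTatuzawa, §3 (7) p. 171] -/
theorem left_kernel_bound3 {κ : ℝ} (hκ0 : 0 ≤ κ) (hκ : κ < 1 / 2) (y : ℝ) :
    (1 / 4 + y ^ 2) ^ 2 * ‖hoffKernel (((-3 / 2 + κ : ℝ) : ℂ) + y * I)‖ ≤ 1 / (49 / 4 + y ^ 2) := by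
  have hwj : ∀ j : ℝ, (((-3 / 2 + κ : ℝ) : ℂ) + y * I) + j = (((-3 / 2 + κ + j) : ℝ) : ℂ) + y * I := by
    intro j; push_cast; ring
  have e0 : (((-3 / 2 + κ : ℝ) : ℂ) + y * I) = (((-3 / 2 + κ + 0) : ℝ) : ℂ) + y * I := by
    push_cast; ring
  unfold hoffKernel
  rw [norm_div, norm_one]
  simp only [norm_mul]
  rw [show (2 : ℂ) = ((2 : ℝ) : ℂ) by norm_num, show (3 : ℂ) = ((3 : ℝ) : ℂ) by norm_num,
    show (4 : ℂ) = ((4 : ℝ) : ℂ) by norm_num, show (5 : ℂ) = ((5 : ℝ) : ℂ) by norm_num,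
    show (6 : ℂ) = ((6 : ℝ) : ℂ) by norm_num, hwj, hwj, hwj, hwj, hwj]
  rw [e0]
  have hsq : ∀ j : ℝ, ‖(((-3 / 2 + κ + j) : ℝ) : ℂ) + y * I‖ ^ 2 = (-3 / 2 + κ + j) ^ 2 + y ^ 2 :=
    fun j ↦ norm_sq_ofReal_add_mul_I' _ _
  have hp : ∀ j : ℝ, -3 / 2 + κ + j ≠ 0 → 0 < ‖(((-3 / 2 + κ + j) : ℝ) : ℂ) + y * I‖ :=
    fun j hj ↦ norm_line_pos₃ hj y
  have hA := hp 0 (by linarith only [hκ]); have hB2 := hp 2 (by linarith only [hκ0])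
  have hB3 := hp 3 (by linarith only [hκ0]); have hB4 := hp 4 (by linarith only [hκ0])
  have hB5 := hp 5 (by linarith only [hκ0]); have hB6 := hp 6 (by linarith only [hκ0])
  -- Claim 1: `¼ + y² ≤ ‖c₀+iy‖ ‖c₂+iy‖`
  have h1 : 1 / 4 + y ^ 2 ≤ ‖(((-3 / 2 + κ + 0) : ℝ) : ℂ) + y * I‖ *
      ‖(((-3 / 2 + κ + 2) : ℝ) : ℂ) + y * I‖ := by
    refine le_mul_of_le_sq₃ (by positivity) (norm_nonneg _) (norm_nonneg _) ?_ ?_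
    · rw [hsq]; nlinarith only [hκ0, hκ, sq_nonneg y]
    · rw [hsq]; nlinarith only [hκ0, sq_nonneg y]
  -- Claim 2: `¼ + y² ≤ ‖c₃+iy‖ ‖c₄+iy‖`
  have h2 : 1 / 4 + y ^ 2 ≤ ‖(((-3 / 2 + κ + 3) : ℝ) : ℂ) + y * I‖ *
      ‖(((-3 / 2 + κ + 4) : ℝ) : ℂ) + y * I‖ := by
    refine le_mul_of_le_sq₃ (by positivity) (norm_nonneg _) (norm_nonneg _) ?_ ?_
    · rw [hsq]; nlinarith only [hκ0, sq_nonneg y]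
    · rw [hsq]; nlinarith only [hκ0, sq_nonneg y]
  -- Claim 3: `49/4 + y² ≤ ‖c₅+iy‖ ‖c₆+iy‖`
  have h3 : 49 / 4 + y ^ 2 ≤ ‖(((-3 / 2 + κ + 5) : ℝ) : ℂ) + y * I‖ *
      ‖(((-3 / 2 + κ + 6) : ℝ) : ℂ) + y * I‖ := by
    refine le_mul_of_le_sq₃ (by positivity) (norm_nonneg _) (norm_nonneg _) ?_ ?_
    · rw [hsq]; nlinarith only [hκ0, sq_nonneg y]
    · rw [hsq]; nlinarith only [hκ0, sq_nonneg y]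
  set A := ‖(((-3 / 2 + κ + 0) : ℝ) : ℂ) + y * I‖
  set B2 := ‖(((-3 / 2 + κ + 2) : ℝ) : ℂ) + y * I‖
  set B3 := ‖(((-3 / 2 + κ + 3) : ℝ) : ℂ) + y * I‖
  set B4 := ‖(((-3 / 2 + κ + 4) : ℝ) : ℂ) + y * I‖
  set B5 := ‖(((-3 / 2 + κ + 5) : ℝ) : ℂ) + y * I‖
  set B6 := ‖(((-3 / 2 + κ + 6) : ℝ) : ℂ) + y * I‖
  have hD : 0 < A * B2 * B3 * B4 * B5 * B6 := by positivity
  rw [mul_one_div, div_le_div_iff₀ hD (by positivity), one_mul]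
  calc (1 / 4 + y ^ 2) ^ 2 * (49 / 4 + y ^ 2)
      = (1 / 4 + y ^ 2) * (1 / 4 + y ^ 2) * (49 / 4 + y ^ 2) := by ring
    _ ≤ (A * B2) * (B3 * B4) * (B5 * B6) := by gcongr
    _ = A * B2 * B3 * B4 * B5 * B6 := by ring

/-- `x^w` is entire for `x > 0`. [folklore] -/
private lemma differentiable_cpow_const₃ {x : ℝ} (hx : 0 < x) :
    Differentiable ℂ fun w : ℂ ↦ (x : ℂ) ^ w :=
  differentiable_id.const_cpow (Or.inl (ofReal_ne_zero.2 hx.ne'))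

/-- Non-vanishing of the linear factors on `Re w > −3`. [folklore] -/
private lemma add_ne_zero_of_re₃ {w : ℂ} {j : ℝ} (h : -j < w.re) : w + j ≠ 0 := by
  intro h'; have := congrArg Complex.re h'; simp at this; linarith

/-- The kernel without its pole at `0`: `K₀(s) = 1/((s+2)(s+3)(s+4)(s+5)(s+6))`. [folklore] -/
private def hoffK0₃ (w : ℂ) : ℂ := 1 / ((w + 2) * (w + 3) * (w + 4) * (w + 5) * (w + 6))

/-- `K = K₀/(w − 0)`. [folklore] -/
private lemma hoffKernel_eq_K0_div₃ {w : ℂ} (h0 : w ≠ 0) : hoffKernel w = hoffK0₃ w / (w - 0) := by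
  unfold hoffKernel hoffK0₃; rw [sub_zero]; field_simp

/-- `K₀` is holomorphic on `Re w > −2`. [folklore] -/
private lemma differentiableAt_hoffK0₃ {w : ℂ} (hw : -2 < w.re) : DifferentiableAt ℂ hoffK0₃ w := by
  unfold hoffK0₃
  have h2 := add_ne_zero_of_re₃ (w := w) (j := 2) (by linarith)
  have h3 := add_ne_zero_of_re₃ (w := w) (j := 3) (by linarith)
  have h4 := add_ne_zero_of_re₃ (w := w) (j := 4) (by linarith)
  have h5 := add_ne_zero_of_re₃ (w := w) (j := 5) (by linarith)
  have h6 := add_ne_zero_of_re₃ (w := w) (j := 6) (by linarith)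
  push_cast at h2 h3 h4 h5 h6
  refine (differentiableAt_const _).div (by fun_prop) ?_
  exact mul_ne_zero (mul_ne_zero (mul_ne_zero (mul_ne_zero h2 h3) h4) h5) h6

/-- `K` is holomorphic on `Re w > −2` away from `0`. [folklore] -/
private lemma differentiableAt_hoffKernel₃ {w : ℂ} (hw : -2 < w.re) (h0 : w ≠ 0) :
    DifferentiableAt ℂ hoffKernel w := by
  have h2 := add_ne_zero_of_re₃ (w := w) (j := 2) (by linarith)
  push_cast at h2
  have hev : hoffKernel =ᶠ[𝓝 w] fun w ↦ hoffK0₃ w / (w - 0) := by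
    filter_upwards [isOpen_ne.mem_nhds h0] with z hz
    exact hoffKernel_eq_K0_div₃ hz
  refine DifferentiableAt.congr_of_eventuallyEq ?_ hev
  exact (differentiableAt_hoffK0₃ hw).div (differentiableAt_id.sub (differentiableAt_const _))
    (by rw [sub_zero]; exact h0)

/-- `‖K(w)‖ ≤ |Im w|^{-6}`. [folklore] -/
private lemma norm_hoffKernel_le_of_im₃ {w : ℂ} (hT : 0 < |w.im|) : ‖hoffKernel w‖ ≤ 1 / |w.im| ^ 6 := by
  have hj : ∀ j : ℝ, |w.im| ≤ ‖w + j‖ := fun j ↦ by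
    have := abs_im_le_norm (w + j); simpa using this
  have h0 : |w.im| ≤ ‖w‖ := abs_im_le_norm w
  unfold hoffKernel
  rw [norm_div, norm_one]
  simp only [norm_mul]
  have h2 := hj 2; have h3 := hj 3; have h4 := hj 4; have h5 := hj 5; have h6 := hj 6
  push_cast at h2 h3 h4 h5 h6
  have hprod : |w.im| ^ 6 ≤ ‖w‖ * ‖w + 2‖ * ‖w + 3‖ * ‖w + 4‖ * ‖w + 5‖ * ‖w + 6‖ := by
    calc |w.im| ^ 6 = |w.im| * |w.im| * |w.im| * |w.im| * |w.im| * |w.im| := by ring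
      _ ≤ _ := by gcongr
  exact one_div_le_one_div_of_le (by positivity) hprod

/-- `x^σ ≤ x^a + x^b` for `σ ∈ [a, b]`, `x > 0`. [folklore] -/
private lemma rpow_le_add_of_mem₃ {x a b σ : ℝ} (hx : 0 < x) (h1 : a ≤ σ) (h2 : σ ≤ b) :
    x ^ σ ≤ x ^ a + x ^ b := by
  have hxa : 0 < x ^ a := Real.rpow_pos_of_pos hx a
  have hxb : 0 < x ^ b := Real.rpow_pos_of_pos hx b
  rcases le_or_gt 1 x with hx1 | hx1
  · have := Real.rpow_le_rpow_of_exponent_le hx1 h2; linarith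
  · have := Real.rpow_le_rpow_of_exponent_ge hx hx1.le h1; linarith

/-! ### The integrand on the two lines and in the strip -/

/-- The integrand is continuous along every vertical line `Re s = c` with `c + β ≠ 1`, `c > −2`,
`c ≠ 0`. [folklore] -/
private lemma continuous_hoffG3_line (hχ : χ ≠ 1) (hχ' : χ' ≠ 1) (hψ : ψ ≠ 1) {β x c : ℝ} (hx : 0 < x)
    (hc1 : c + β ≠ 1) (hc2 : -2 < c) (hc0 : c ≠ 0) :
    Continuous fun y : ℝ ↦ hoffG3 χ χ' ψ β x (c + y * I) := by
  refine continuous_iff_continuousAt.2 fun y ↦ ?_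
  have hl : Continuous fun y : ℝ ↦ (c : ℂ) + y * I := by fun_prop
  have hwre : ((c : ℂ) + y * I).re = c := by simp
  have hne1 : (c : ℂ) + y * I + β ≠ 1 := fun h ↦ hc1 (by have := congrArg Complex.re h; simpa using this)
  have hne0 : (c : ℂ) + y * I ≠ 0 := fun h ↦ hc0 (by have := congrArg Complex.re h; simpa using this)
  have hd : DifferentiableAt ℂ (hoffG3 χ χ' ψ β x) ((c : ℂ) + y * I) := by
    unfold hoffG3
    have hlin : DifferentiableAt ℂ (fun w : ℂ ↦ w + β) ((c : ℂ) + y * I) :=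
      differentiableAt_id.add (differentiableAt_const _)
    have hz : DifferentiableAt ℂ (hoffF χ χ' ψ ∘ fun w : ℂ ↦ w + β) ((c : ℂ) + y * I) :=
      (differentiableAt_hoffF hχ hχ' hψ (s := (c : ℂ) + y * I + β) hne1).comp ((c : ℂ) + y * I) hlin
    exact (hz.mul (differentiable_cpow_const₃ hx _)).mul
      (differentiableAt_hoffKernel₃ (by rw [hwre]; exact hc2) hne0)
  exact ContinuousAt.comp (g := hoffG3 χ χ' ψ β x) (f := fun y : ℝ ↦ (c : ℂ) + y * I)
    hd.continuousAt hl.continuousAt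

/-- **The left line, pointwise (the input of (7))**: for primitive `χ, χ′, ψ` modulo `q, q′, k > 1`,
`½ < β < 1`, `x > 0`, on `Re s = −½ − β`:
`‖G(s)‖ ≤ C_F · x^{−½−β} · (49/4 + t²)⁻¹`. [cite: Hoffstein1980SiegelTatuzawa, §3 (7) p. 171] -/
theorem norm_hoffG3_left_le (hq : 1 < q) (hq' : 1 < q') (hk : 1 < k) (hχ : χ.IsPrimitive)
    (hχ' : χ'.IsPrimitive) (hψ : ψ.IsPrimitive) {β : ℝ} (hβ0 : 1 / 2 < β) (hβ1 : β ≤ 1) {x : ℝ}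
    (hx : 0 < x) (y : ℝ) :
    ‖hoffG3 χ χ' ψ β x (↑(-1 / 2 - β) + y * I)‖ ≤
      leftConst3 q q' k * x ^ (-1 / 2 - β) * (49 / 4 + y ^ 2)⁻¹ := by
  unfold hoffG3
  have e1 : ((-1 / 2 - β : ℝ) : ℂ) + y * I + β = -1 / 2 + y * I := by push_cast; ring
  have e2 : ((-1 / 2 - β : ℝ) : ℂ) + y * I = (((-3 / 2 + (1 - β)) : ℝ) : ℂ) + y * I := by push_cast; ring
  rw [norm_mul, norm_mul, e1, norm_cpow_eq_rpow_re_of_pos hx]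
  have hre : (((-1 / 2 - β : ℝ) : ℂ) + y * I).re = -1 / 2 - β := by simp
  rw [hre]
  have hF := norm_hoffF_neg_half_le hq hq' hk hχ hχ' hψ y
  have hK := left_kernel_bound3 (κ := 1 - β) (by linarith) (by linarith) y
  rw [← e2] at hK
  have hC0 : 0 ≤ leftConst3 q q' k := by
    unfold leftConst3; have := (bigZ_pos (by norm_num : (1:ℝ) < 3 / 2)).le; positivity
  have hxpos : 0 < x ^ (-1 / 2 - β) := Real.rpow_pos_of_pos hx _
  have hP : 0 < (1 / 4 + y ^ 2) ^ 2 := by positivity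
  calc ‖hoffF χ χ' ψ (-1 / 2 + y * I)‖ * x ^ (-1 / 2 - β) * ‖hoffKernel (↑(-1 / 2 - β) + y * I)‖
      ≤ (leftConst3 q q' k * (1 / 4 + y ^ 2) ^ 2) * x ^ (-1 / 2 - β) *
          ‖hoffKernel (↑(-1 / 2 - β) + y * I)‖ := by gcongr
    _ = leftConst3 q q' k * x ^ (-1 / 2 - β) *
          ((1 / 4 + y ^ 2) ^ 2 * ‖hoffKernel (↑(-1 / 2 - β) + y * I)‖) := by ring
    _ ≤ leftConst3 q q' k * x ^ (-1 / 2 - β) * (1 / (49 / 4 + y ^ 2)) := by gcongr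
    _ = _ := by rw [one_div]

/-- Integrability of `(49/4 + y²)⁻¹`. [folklore] -/
private lemma integrable_inv_const_add_sq₃ : Integrable fun y : ℝ ↦ (49 / 4 + y ^ 2)⁻¹ := by
  have h := Literature.Analysis.SpecialFunctions.integrable_inv_sq_add_sq_of_ne_zero
    (a := (7 / 2 : ℝ)) (by norm_num)
  refine h.congr (Eventually.of_forall fun y ↦ ?_)
  simp only
  norm_num

/-- `∫ dy/(49/4 + y²) = 2π/7`. [folklore] -/
private lemma integral_inv_const_add_sq₃ : ∫ y : ℝ, (49 / 4 + y ^ 2)⁻¹ = π / (7 / 2) := by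
  have h := Literature.Analysis.SpecialFunctions.integral_inv_sq_add_sq_eq_pi_div
    (a := (7 / 2 : ℝ)) (by norm_num)
  rw [show ((7 / 2 : ℝ)) ^ 2 = 49 / 4 by norm_num] at h
  exact h

/-- **The left line is absolutely integrable.** [cite: Hoffstein1980SiegelTatuzawa, §3 (7) p. 171] -/
theorem integrable_hoffG3_left (hq : 1 < q) (hq' : 1 < q') (hk : 1 < k) (hχ : χ.IsPrimitive)
    (hχ' : χ'.IsPrimitive) (hψ : ψ.IsPrimitive) {β : ℝ} (hβ0 : 1 / 2 < β) (hβ1 : β < 1) {x : ℝ}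
    (hx : 0 < x) :
    Integrable fun y : ℝ ↦ hoffG3 χ χ' ψ β x (↑(-1 / 2 - β) + y * I) := by
  have hχ1 := ne_one_of_isPrimitive₃ hχ hq
  have hχ'1 := ne_one_of_isPrimitive₃ hχ' hq'
  have hψ1 := ne_one_of_isPrimitive₃ hψ hk
  refine (integrable_inv_const_add_sq₃.const_mul (leftConst3 q q' k * x ^ (-1 / 2 - β))).mono' ?_
    (Eventually.of_forall (norm_hoffG3_left_le hq hq' hk hχ hχ' hψ hβ0 hβ1.le hx))
  exact (continuous_hoffG3_line hχ1 hχ'1 hψ1 hx (by linarith) (by linarith) (by linarith)).aestronglyMeasurable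

/-- **(7): `∫ ‖G‖ ≤ C_F x^{−½−β} · 2π/7` on the left line.** [cite: Hoffstein1980SiegelTatuzawa, §3 (7) p. 171] -/
theorem integral_norm_hoffG3_left_le (hq : 1 < q) (hq' : 1 < q') (hk : 1 < k) (hχ : χ.IsPrimitive)
    (hχ' : χ'.IsPrimitive) (hψ : ψ.IsPrimitive) {β : ℝ} (hβ0 : 1 / 2 < β) (hβ1 : β < 1) {x : ℝ}
    (hx : 0 < x) :
    ∫ y : ℝ, ‖hoffG3 χ χ' ψ β x (↑(-1 / 2 - β) + y * I)‖ ≤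
      leftConst3 q q' k * x ^ (-1 / 2 - β) * (π / (7 / 2)) := by
  rw [← integral_inv_const_add_sq₃, ← integral_const_mul]
  refine integral_mono_of_nonneg (Eventually.of_forall fun y ↦ norm_nonneg _)
    (integrable_inv_const_add_sq₃.const_mul _)
    (Eventually.of_forall (norm_hoffG3_left_le hq hq' hk hχ hχ' hψ hβ0 hβ1.le hx))

omit [NeZero q'] [NeZero k] in
/-- **Linear growth of `L(s, χ)` in the strip `−½ ≤ σ ≤ 2`, `|t| ≥ 2`** (`χ` primitive mod `q > 1`):
Rademacher's Theorem 3 with `η = ½` for `σ ≤ 3/2` and `|L| ≤ ζ(3/2)` beyond.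
[cite: Rademacher1959, Theorem 3] -/
theorem exists_norm_LFunction_le_abs_im (hq : 1 < q) (hχ : χ.IsPrimitive) :
    ∃ C : ℝ, 0 < C ∧ ∀ s : ℂ, -1 / 2 ≤ s.re → s.re ≤ 2 → 2 ≤ |s.im| →
      ‖χ.LFunction s‖ ≤ C * |s.im| := by
  have hZ : 0 < bigZ (3 / 2) := bigZ_pos (by norm_num)
  have hζn : ‖riemannZeta (1 + (1 / 2 : ℝ))‖ = bigZ (3 / 2) := by
    rw [bigZ_eq_norm (by norm_num : (1:ℝ) < 3 / 2)]
    have e : (1 : ℂ) + ((1 / 2 : ℝ) : ℂ) = ((3 / 2 : ℝ) : ℂ) := by push_cast; ring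
    rw [e]
  refine ⟨((q : ℝ) + 1) * bigZ (3 / 2), by positivity, fun s hσ1 hσ2 ht ↦ ?_⟩
  have hq0 : (0 : ℝ) < q := by exact_mod_cast (zero_lt_one.trans hq)
  have ht0 : 0 < |s.im| := by linarith
  rcases le_or_gt s.re (3 / 2) with hσ | hσ
  · -- Rademacher
    have h := Rademacher1959.norm_LFunction_le_norm_zeta hq hχ (η := 1 / 2) (by norm_num) le_rfl
      (s := s) (by linarith) (by linarith)
    rw [hζn] at h
    set B : ℝ := (q : ℝ) * ‖1 + s‖ / (2 * π) with hB
    set e : ℝ := (1 + 1 / 2 - s.re) / 2 with he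
    have hB0 : 0 ≤ B := by rw [hB]; positivity
    have he0 : 0 ≤ e := by rw [he]; linarith
    have he1 : e ≤ 1 := by rw [he]; linarith
    have h1s : ‖1 + s‖ ≤ |s.im| + 3 := by
      have := norm_le_abs_re_add_abs_im (1 + s)
      have hre : |1 + s.re| ≤ 3 := by rw [abs_le]; constructor <;> linarith
      simp at this; linarith
    have hBle : B ≤ (q : ℝ) * |s.im| := by
      rw [hB, div_le_iff₀ (by positivity)]
      have hπ3 : (3 : ℝ) < π := Real.pi_gt_three
      have h6 : |s.im| + 3 ≤ |s.im| * (2 * π) := by nlinarith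
      calc (q : ℝ) * ‖1 + s‖ ≤ (q : ℝ) * (|s.im| + 3) := by gcongr
        _ ≤ (q : ℝ) * (|s.im| * (2 * π)) := by gcongr
        _ = (q : ℝ) * |s.im| * (2 * π) := by ring
    have hBe : B ^ e ≤ (q : ℝ) * |s.im| + |s.im| := by
      rcases le_or_gt 1 B with hB1 | hB1
      · calc B ^ e ≤ B ^ (1 : ℝ) := Real.rpow_le_rpow_of_exponent_le hB1 he1
          _ = B := Real.rpow_one B
          _ ≤ (q : ℝ) * |s.im| + |s.im| := by linarith
      · calc B ^ e ≤ 1 := Real.rpow_le_one hB0 hB1.le he0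
          _ ≤ (q : ℝ) * |s.im| + |s.im| := by nlinarith
    calc ‖χ.LFunction s‖ ≤ B ^ e * bigZ (3 / 2) := h
      _ ≤ ((q : ℝ) * |s.im| + |s.im|) * bigZ (3 / 2) := by gcongr
      _ = ((q : ℝ) + 1) * bigZ (3 / 2) * |s.im| := by ring
  · -- `σ > 3/2`: `|L| ≤ ζ(σ) ≤ ζ(3/2)`
    have h := norm_LFunction_le_bigZ χ (σ := s.re) (by linarith) s.im
    rw [show ((s.re : ℝ) : ℂ) + (s.im : ℝ) * I = s from Complex.re_add_im s] at h
    have h2 := bigZ_antitone' (σ₁ := 3 / 2) (σ₂ := s.re) (by norm_num) hσ.le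
    calc ‖χ.LFunction s‖ ≤ bigZ (3 / 2) := h.trans h2
      _ = 1 * bigZ (3 / 2) * 1 := by ring
      _ ≤ ((q : ℝ) + 1) * bigZ (3 / 2) * |s.im| := by gcongr <;> linarith

/-- **Polynomial growth `‖F(σ + it)‖ ≤ C |t|⁵` in `−½ ≤ σ ≤ 2`, `|t| ≥ 2`** (so that the horizontal
sides of the contour vanish against `|K| ≤ |t|^{−6}`). [cite: Hoffstein1980SiegelTatuzawa, §3 (10) p. 171] -/
theorem exists_norm_hoffF_le_pow (hq : 1 < q) (hq' : 1 < q') (hk : 1 < k) (hχ : χ.IsPrimitive)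
    (hχ' : χ'.IsPrimitive) (hψ : ψ.IsPrimitive) :
    ∃ C : ℝ, 0 < C ∧ ∀ s : ℂ, -1 / 2 ≤ s.re → s.re ≤ 2 → 2 ≤ |s.im| →
      ‖hoffF χ χ' ψ s‖ ≤ C * |s.im| ^ 5 := by
  obtain ⟨C₀, hC₀, h₀⟩ := exists_norm_riemannZeta_le_sq
  obtain ⟨C₁, hC₁, h₁⟩ := exists_norm_LFunction_le_abs_im hq hχ
  obtain ⟨C₂, hC₂, h₂⟩ := exists_norm_LFunction_le_abs_im (χ := χ') hq' hχ'
  obtain ⟨C₃, hC₃, h₃⟩ := exists_norm_LFunction_le_abs_im (χ := ψ) hk hψ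
  refine ⟨C₀ * C₁ * (C₂ * C₃), by positivity, fun s hσ1 hσ2 ht ↦ ?_⟩
  have ht2 : s.im ^ 2 = |s.im| ^ 2 := (sq_abs _).symm
  unfold hoffF zetaL
  rw [norm_mul, norm_mul, norm_mul]
  calc ‖riemannZeta s‖ * ‖χ.LFunction s‖ * (‖χ'.LFunction s‖ * ‖ψ.LFunction s‖)
      ≤ (C₀ * s.im ^ 2) * (C₁ * |s.im|) * ((C₂ * |s.im|) * (C₃ * |s.im|)) := by
        gcongr
        · exact h₀ s (by linarith) hσ2 ht
        · exact h₁ s hσ1 hσ2 ht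
        · exact h₂ s hσ1 hσ2 ht
        · exact h₃ s hσ1 hσ2 ht
    _ = C₀ * C₁ * (C₂ * C₃) * |s.im| ^ 5 := by rw [ht2]; ring

/-! ### The contour identity (10) -/

/-- **Hoffstein's contour shift, three-character version of (10), p. 171.** For primitive `χ, χ′, ψ`
modulo `q, q′, k > 1`, `½ < β < 1` and `x > 0`:
`∫_{Re s = 2−β} G − ∫_{Re s = −½−β} G = 2π (Res_{1−β} + Res_0)` with
`Res_{1−β} = L(1,χ)L(1,χ′)L(1,ψ) x^{1−β} K(1−β)` and `Res_0 = F(β)/720`.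
[cite: Hoffstein1980SiegelTatuzawa, §3 (10) p. 171] -/
theorem hoffstein_contour_identity3 (hq : 1 < q) (hq' : 1 < q') (hk : 1 < k) (hχ : χ.IsPrimitive)
    (hχ' : χ'.IsPrimitive) (hψ : ψ.IsPrimitive) {β : ℝ} (hβ0 : 1 / 2 < β) (hβ1 : β < 1) {x : ℝ}
    (hx : 0 < x) :
    (∫ y : ℝ, hoffG3 χ χ' ψ β x (↑(2 - β) + y * I)) -
        ∫ y : ℝ, hoffG3 χ χ' ψ β x (↑(-1 / 2 - β) + y * I) =
      2 * π * (χ.LFunction 1 * (χ'.LFunction 1 * ψ.LFunction 1) * (x : ℂ) ^ ((1 : ℂ) - β) *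
          hoffKernel ((1 : ℂ) - β) + hoffF χ χ' ψ β / 720) := by
  have hχ1 := ne_one_of_isPrimitive₃ hχ hq
  have hχ'1 := ne_one_of_isPrimitive₃ hχ' hq'
  have hψ1 := ne_one_of_isPrimitive₃ hψ hk
  set a : ℝ := -1 / 2 - β with ha
  set b : ℝ := 2 - β with hb
  have hab : a < b := by rw [ha, hb]; linarith
  set p₁ : ℂ := (1 : ℂ) - β with hp₁
  classical
  set S : Finset ℂ := {p₁, 0} with hS
  set r : ℂ → ℂ := fun p ↦ if p = p₁ then
      χ.LFunction 1 * (χ'.LFunction 1 * ψ.LFunction 1) * (x : ℂ) ^ p₁ * hoffKernel p₁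
    else hoffF χ χ' ψ β / 720 with hr
  have hp₁re : p₁.re = 1 - β := by simp [hp₁]
  have hp₁0 : p₁ ≠ 0 := fun h ↦ by
    have := congrArg Complex.re h; rw [hp₁re] at this; simp at this; linarith
  have hsum : ∑ p ∈ S, r p = χ.LFunction 1 * (χ'.LFunction 1 * ψ.LFunction 1) * (x : ℂ) ^ p₁ *
      hoffKernel p₁ + hoffF χ χ' ψ β / 720 := by
    rw [hS, Finset.sum_insert (by simp [hp₁0]), Finset.sum_singleton]
    simp only [hr, if_neg hp₁0.symm, if_true]
  set U : Set ℂ := {w : ℂ | -2 < w.re} with hU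
  have hUo : IsOpen U := isOpen_lt continuous_const Complex.continuous_re
  have hxw := differentiable_cpow_const₃ hx
  have hmemS : ∀ p : ℂ, p ∈ S ↔ p = p₁ ∨ p = 0 := fun p ↦ by
    rw [hS, Finset.mem_insert, Finset.mem_singleton]
  obtain ⟨C, hC, hgrowth⟩ := exists_norm_hoffF_le_pow hq hq' hk hχ hχ' hψ
  have key := integral_vertical_sub_eq_sum_of_simplePoles (F := hoffG3 χ χ' ψ β x) hab S r U hUo
    (fun w hw ↦ by
      simp only [Set.mem_preimage, Set.mem_Icc] at hw; show -2 < w.re; rw [ha] at hw; linarith)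
    (fun p hp ↦ by
      rcases (hmemS p).1 hp with rfl | rfl
      · rw [hp₁re, ha, hb]; constructor <;> linarith
      · rw [ha, hb]; simp; constructor <;> linarith)
    ?hF ?hpole ?hia ?hib ?hdecay
  · rw [key, hsum]
  -- (hF) holomorphy off the poles
  · intro w hw
    rcases hw with ⟨hwU, hwS⟩
    have hwU' : -2 < w.re := hwU
    have hwS' : ¬ (w = p₁ ∨ w = 0) := fun h ↦ hwS ((hmemS w).2 h)
    push Not at hwS'
    obtain ⟨hw1, hw0⟩ := hwS'
    have hwβ : w + β ≠ 1 := fun h ↦ hw1 (by rw [hp₁]; linear_combination h)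
    refine DifferentiableAt.differentiableWithinAt ?_
    unfold hoffG3
    have hlin : DifferentiableAt ℂ (fun w : ℂ ↦ w + β) w :=
      differentiableAt_id.add (differentiableAt_const _)
    have hz : DifferentiableAt ℂ (hoffF χ χ' ψ ∘ fun w : ℂ ↦ w + β) w :=
      (differentiableAt_hoffF hχ1 hχ'1 hψ1 (s := w + β) hwβ).comp w hlin
    exact (hz.mul (hxw w)).mul (differentiableAt_hoffKernel₃ hwU' hw0)
  -- (hpole) the two simple poles
  · intro p hp
    rcases (hmemS p).1 hp with rfl | rfl
    · -- `s = 1 − β`: pole of `ζ(s + β)`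
      set V : Set ℂ := {w : ℂ | w ≠ 0 ∧ -2 < w.re} with hV
      refine ⟨fun w ↦ zetaReg1 (w + β) * χ.LFunction (w + β) * (χ'.LFunction (w + β) * ψ.LFunction (w + β)) *
        (x : ℂ) ^ w * hoffKernel w, V, ?_, ?_, ?_, ?_⟩
      · exact (isOpen_ne.inter (isOpen_lt continuous_const Complex.continuous_re)).mem_nhds
          ⟨hp₁0, by show -2 < p₁.re; rw [hp₁re]; linarith⟩
      · intro w hw
        rcases hw with ⟨hw0, hw2⟩
        refine DifferentiableAt.differentiableWithinAt ?_
        have hlin : DifferentiableAt ℂ (fun w : ℂ ↦ w + β) w :=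
          differentiableAt_id.add (differentiableAt_const _)
        have hz : DifferentiableAt ℂ (fun w : ℂ ↦ zetaReg1 (w + β)) w :=
          (differentiable_zetaReg1 _).comp w hlin
        have hL : DifferentiableAt ℂ (fun w : ℂ ↦ χ.LFunction (w + β)) w :=
          (differentiable_LFunction hχ1 _).comp w hlin
        have hL' : DifferentiableAt ℂ (fun w : ℂ ↦ χ'.LFunction (w + β)) w :=
          (differentiable_LFunction hχ'1 _).comp w hlin
        have hLψ : DifferentiableAt ℂ (fun w : ℂ ↦ ψ.LFunction (w + β)) w :=
          (differentiable_LFunction hψ1 _).comp w hlin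
        exact (((hz.mul hL).mul (hL'.mul hLψ)).mul (hxw w)).mul (differentiableAt_hoffKernel₃ hw2 hw0)
      · simp only [hr, if_pos rfl]
        rw [show p₁ + β = 1 by rw [hp₁]; ring, zetaReg1_one, one_mul]
      · intro w _ hwp
        have hwβ : w + β ≠ 1 := fun h ↦ hwp (by rw [hp₁]; linear_combination h)
        unfold hoffG3
        rw [hoffF_eq_div_of_ne_one χ χ' ψ hwβ, show w + ↑β - 1 = w - p₁ by rw [hp₁]; ring]
        field_simp
    · -- `s = 0`: pole of the kernel
      set V : Set ℂ := {w : ℂ | w ≠ p₁ ∧ -2 < w.re} with hV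
      refine ⟨fun w ↦ hoffF χ χ' ψ (w + β) * (x : ℂ) ^ w * hoffK0₃ w, V, ?_, ?_, ?_, ?_⟩
      · exact (isOpen_ne.inter (isOpen_lt continuous_const Complex.continuous_re)).mem_nhds
          ⟨hp₁0.symm, by show -2 < (0:ℂ).re; simp⟩
      · intro w hw
        rcases hw with ⟨hw1, hw2⟩
        have hwβ : w + β ≠ 1 := fun h ↦ hw1 (by rw [hp₁]; linear_combination h)
        refine DifferentiableAt.differentiableWithinAt ?_
        have hlin : DifferentiableAt ℂ (fun w : ℂ ↦ w + β) w :=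
          differentiableAt_id.add (differentiableAt_const _)
        have hz : DifferentiableAt ℂ (hoffF χ χ' ψ ∘ fun w : ℂ ↦ w + β) w :=
          (differentiableAt_hoffF hχ1 hχ'1 hψ1 (s := w + β) hwβ).comp w hlin
        exact (hz.mul (hxw w)).mul (differentiableAt_hoffK0₃ hw2)
      · simp only [hr, if_neg hp₁0.symm]
        rw [zero_add, cpow_zero, mul_one]
        unfold hoffK0₃; ring
      · intro w _ hw0
        unfold hoffG3
        rw [hoffKernel_eq_K0_div₃ hw0]
        field_simp
  -- (hia) integrability on the left line
  · exact integrable_hoffG3_left hq hq' hk hχ hχ' hψ hβ0 hβ1 hx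
  -- (hib) integrability on the right line
  · have hb0 : 0 < b := by rw [hb]; linarith
    have hK := integrable_hoffKernel_vertical hb0
    have hcont : Continuous fun y : ℝ ↦ hoffF χ χ' ψ (↑b + y * I + β) * (x : ℂ) ^ ((b : ℂ) + y * I) := by
      refine Continuous.mul ?_ ((differentiable_cpow_const₃ hx).continuous.comp (by fun_prop))
      refine continuous_iff_continuousAt.2 fun y ↦ ?_
      have hne : (b : ℂ) + y * I + β ≠ 1 := by
        intro h
        have h' := congrArg Complex.re h
        simp only [add_re, ofReal_re, mul_re, I_re, I_im, ofReal_im, mul_zero, zero_mul, sub_zero,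
          one_re] at h'
        rw [hb] at h'; linarith
      exact ContinuousAt.comp (g := hoffF χ χ' ψ) (f := fun y : ℝ ↦ (b : ℂ) + y * I + β)
        (differentiableAt_hoffF hχ1 hχ'1 hψ1 hne).continuousAt
        (by fun_prop : Continuous fun y : ℝ ↦ (b : ℂ) + y * I + β).continuousAt
    have hZ2 : 0 ≤ bigZ 2 := (bigZ_pos (by norm_num)).le
    have hint := hK.bdd_mul hcont.aestronglyMeasurable (c := bigZ 2 * bigZ 2 * (bigZ 2 * bigZ 2) * x ^ b)
      (Eventually.of_forall fun y ↦ by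
        rw [norm_mul, norm_cpow_eq_rpow_re_of_pos hx]
        have hre : ((b : ℂ) + y * I).re = b := by simp
        rw [hre]
        have e : (b : ℂ) + y * I + β = ((2 : ℝ) : ℂ) + y * I := by rw [hb]; push_cast; ring
        rw [e, hoffF, zetaL, norm_mul, norm_mul, norm_mul]
        have h1 := norm_riemannZeta_le_bigZ (σ := 2) (by norm_num) y
        have h2 := norm_LFunction_le_bigZ χ (σ := 2) (by norm_num) y
        have h3 := norm_LFunction_le_bigZ χ' (σ := 2) (by norm_num) y
        have h4 := norm_LFunction_le_bigZ ψ (σ := 2) (by norm_num) y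
        have hxb : 0 ≤ x ^ b := (Real.rpow_pos_of_pos hx b).le
        calc ‖riemannZeta (↑(2:ℝ) + y * I)‖ * ‖χ.LFunction (↑(2:ℝ) + y * I)‖ *
              (‖χ'.LFunction (↑(2:ℝ) + y * I)‖ * ‖ψ.LFunction (↑(2:ℝ) + y * I)‖) * x ^ b
            ≤ bigZ 2 * bigZ 2 * (bigZ 2 * bigZ 2) * x ^ b := by gcongr)
    exact hint
  -- (hdecay) the horizontal sides
  · intro ε hε
    set M : ℝ := x ^ a + x ^ b with hM
    have hM0 : 0 < M := by rw [hM]; exact add_pos (Real.rpow_pos_of_pos hx a) (Real.rpow_pos_of_pos hx b)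
    refine ⟨max 2 (C * M / ε), fun T hT σ hσ ↦ ?_⟩
    have hT2 : 2 ≤ |T| := (le_max_left _ _).trans hT
    have hT1 : C * M / ε ≤ |T| := (le_max_right _ _).trans hT
    have hTpos : 0 < |T| := by linarith
    set w : ℂ := (σ : ℂ) + T * I with hw
    have hwre : w.re = σ := by simp [hw]
    have hwim : w.im = T := by simp [hw]
    have hz : ‖hoffF χ χ' ψ (w + β)‖ ≤ C * |T| ^ 5 := by
      have := hgrowth (w + β) (by simp [hw]; rw [ha] at hσ; linarith [hσ.1])
        (by simp [hw]; rw [hb] at hσ; linarith [hσ.2]) (by simpa [hw] using hT2)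
      simpa [hw] using this
    have hxσ : ‖(x : ℂ) ^ w‖ ≤ M := by
      rw [norm_cpow_eq_rpow_re_of_pos hx, hwre]; exact rpow_le_add_of_mem₃ hx hσ.1 hσ.2
    have hKn : ‖hoffKernel w‖ ≤ 1 / |T| ^ 6 := by
      have := norm_hoffKernel_le_of_im₃ (w := w) (by rw [hwim]; exact hTpos); rwa [hwim] at this
    calc ‖hoffG3 χ χ' ψ β x w‖ = ‖hoffF χ χ' ψ (w + β)‖ * ‖(x : ℂ) ^ w‖ * ‖hoffKernel w‖ := by
          unfold hoffG3; rw [norm_mul, norm_mul]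
      _ ≤ (C * |T| ^ 5) * M * (1 / |T| ^ 6) := by gcongr
      _ = C * M / |T| := by field_simp
      _ ≤ ε := by rw [div_le_iff₀ hTpos]; rw [div_le_iff₀ hε] at hT1; linarith

/-! ### The right line is the smoothed sum -/

omit [NeZero q] [NeZero q'] [NeZero k] in
/-- **`I = Σ_n a(n) n^{-β} w(n/x)`** in our notation: on `Re s = 2 − β` the integral of `G` is
`2π Σ_n a(n) n^{-β} w(n/x)` (the smoothed Perron formula of `HoffsteinSmoothedPerron.lean` for
`F = Σ a(n) n^{-s}`). [cite: Hoffstein1980SiegelTatuzawa, §3 p. 171 ("it follows that `I = …`")] -/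
theorem integral_hoffG3_right_eq [NeZero q] [NeZero q'] [NeZero k] (χ : DirichletCharacter ℂ q)
    (χ' : DirichletCharacter ℂ q') (ψ : DirichletCharacter ℂ k) {β : ℝ} (hβ1 : β < 1) {x : ℝ}
    (hx : 0 < x) :
    ∫ y : ℝ, hoffG3 χ χ' ψ β x (↑(2 - β) + y * I) =
      2 * π * ∑' n : ℕ, LSeries.term (tripleMul χ χ' ψ ·) β n * hoffWeight ((n : ℝ) / x) := by
  have hc : 0 < 2 - β := by linarith
  have hre : 1 < ((β : ℂ) + ((2 - β : ℝ) : ℂ)).re := by simp only [add_re, ofReal_re]; linarith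
  have hsum := summable_norm_term_tripleMul χ χ' ψ hre
  have h := integral_LSeries_mul_hoffKernel_eq (tripleMul χ χ' ψ ·) (s := (β : ℂ)) hc hsum hx
  rw [← h]
  refine integral_congr_ae (Eventually.of_forall fun y ↦ ?_)
  simp only [hoffG3]
  have e : ((2 - β : ℝ) : ℂ) + y * I + β = (β : ℂ) + ((2 - β : ℝ) : ℂ) + y * I := by ring
  have hre' : 1 < ((β : ℂ) + ((2 - β : ℝ) : ℂ) + y * I).re := by
    simp only [add_re, ofReal_re, mul_re, I_re, I_im, ofReal_im, mul_zero, zero_mul, sub_zero]; linarith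
  rw [e, hoffF_eq_LSeries χ χ' ψ hre']

/-! ### The squares lower bound (three-character version of (9)) -/

omit [NeZero q] [NeZero q'] [NeZero k] in
/-- The real part of one term of the smoothed sum: for `n ≥ 1`,
`Re(a(n) n^{-β} w(n/x)) = a(n) · n^{-β} · w(n/x)` (all three real).
[cite: Hoffstein1980SiegelTatuzawa, §3 (9) p. 171] -/
theorem re_term_tripleMul_mul_hoffWeight (h₁ : χ ^ 2 = 1) (h₂ : χ' ^ 2 = 1) (h₃ : ψ ^ 2 = 1)
    (hlink : LocallyLinked χ χ' ψ) (β : ℝ) {n : ℕ} (hn : n ≠ 0) (u : ℝ) :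
    (LSeries.term (tripleMul χ χ' ψ ·) β n * hoffWeight u).re =
      (tripleMul χ χ' ψ n).re * (n : ℝ) ^ (-β) * (hoffWeight u).re := by
  have hn0 : (0 : ℝ) ≤ n := Nat.cast_nonneg n
  rw [LSeries.term_of_ne_zero hn]
  have hpow : (n : ℂ) ^ (β : ℂ) = (((n : ℝ) ^ β : ℝ) : ℂ) := by
    rw [Complex.ofReal_cpow hn0, ofReal_natCast]
  have hval : (tripleMul χ χ' ψ ·) n / (n : ℂ) ^ (β : ℂ) =
      ((((tripleMul χ χ' ψ n).re * (n : ℝ) ^ (-β) : ℝ)) : ℂ) := by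
    rw [div_eq_mul_inv]
    show tripleMul χ χ' ψ n * ((n : ℂ) ^ (β : ℂ))⁻¹ = _
    rw [hpow, Real.rpow_neg hn0]
    conv_lhs => rw [tripleMul_eq_ofReal_re h₁ h₂ h₃ hlink n]
    push_cast
    ring
  rw [hval, mul_re, ofReal_re, ofReal_im, hoffWeight_im, zero_mul, sub_zero]

omit [NeZero q] [NeZero q'] [NeZero k] in
/-- **Three-character (9)**: for locally linked quadratic `χ, χ′, ψ`, `β ≤ 1` and `x ≥ 40000`,
`Σ_{m ≤ 200} (1/m² − 15 m²/x²) ≤ 6!·I = 720 · Re Σ_n a(n) n^{-β} w(n/x)` (every term is `≥ 0`; keep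
the squares `n = m²`, `a(m²) ≥ 1`, `m^{-2β} ≥ m^{-2}`, `P(u) ≥ 1 − 15u²`). The source keeps the
fourth powers `n ≤ 5` and prints `≥ 1.080`; squares give `≥ 1.639`.
[cite: Hoffstein1980SiegelTatuzawa, §3 (9) p. 171] -/
theorem squares_lower_bound3 (h₁ : χ ^ 2 = 1) (h₂ : χ' ^ 2 = 1) (h₃ : ψ ^ 2 = 1)
    (hlink : LocallyLinked χ χ' ψ) {β : ℝ} (hβ1 : β ≤ 1) {x : ℝ} (hx : 40000 ≤ x) :
    ∑ m ∈ Finset.range 200, (1 / ((m : ℝ) + 1) ^ 2 - 15 * ((m : ℝ) + 1) ^ 2 / x ^ 2) ≤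
      720 * (∑' n : ℕ, LSeries.term (tripleMul χ χ' ψ ·) β n * hoffWeight ((n : ℝ) / x)).re := by
  have hx0 : 0 < x := by linarith
  set f : ℕ → ℂ := fun n ↦ LSeries.term (tripleMul χ χ' ψ ·) β n * hoffWeight ((n : ℝ) / x) with hf
  set N : ℕ := ⌊x⌋₊ with hN
  have hxN : x < N + 1 := Nat.lt_floor_add_one x
  rw [tsum_term_mul_hoffWeight_eq_sum _ _ hx0 N hxN, Complex.re_sum]
  have hnonneg : ∀ n ∈ Finset.range (N + 1), 0 ≤ (f n).re := by
    intro n _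
    rcases eq_or_ne n 0 with rfl | hn
    · simp [hf]
    · rw [hf]
      simp only
      rw [re_term_tripleMul_mul_hoffWeight h₁ h₂ h₃ hlink β hn]
      exact mul_nonneg (mul_nonneg (tripleMul_re_nonneg h₁ h₂ h₃ hlink n)
        (Real.rpow_nonneg (Nat.cast_nonneg n) _)) (hoffWeight_re_nonneg (by positivity))
  set g : ℕ → ℕ := fun m ↦ (m + 1) ^ 2 with hg
  have hginj : Set.InjOn g (Finset.range 200 : Set ℕ) := by
    intro a _ b _ h
    simp only [hg] at h
    have := Nat.pow_left_injective (by norm_num : 2 ≠ 0) h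
    omega
  have hsub : Finset.image g (Finset.range 200) ⊆ Finset.range (N + 1) := by
    intro n hn
    rw [Finset.mem_image] at hn
    obtain ⟨m, hm, rfl⟩ := hn
    rw [Finset.mem_range] at hm ⊢
    have hm' : (m + 1) ^ 2 ≤ 40000 :=
      (Nat.pow_le_pow_left (Nat.succ_le_of_lt hm) 2).trans (by norm_num)
    have h' : (((m + 1) ^ 2 : ℕ) : ℝ) < ((N + 1 : ℕ) : ℝ) := by
      calc (((m + 1) ^ 2 : ℕ) : ℝ) ≤ 40000 := by exact_mod_cast hm'
        _ ≤ x := hx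
        _ < N + 1 := hxN
        _ = ((N + 1 : ℕ) : ℝ) := by push_cast; ring
    show (m + 1) ^ 2 < N + 1
    exact Nat.cast_lt.1 h'
  have hle : ∑ n ∈ Finset.image g (Finset.range 200), (f n).re ≤ ∑ n ∈ Finset.range (N + 1), (f n).re :=
    Finset.sum_le_sum_of_subset_of_nonneg hsub fun n hn _ ↦ hnonneg n hn
  rw [Finset.sum_image hginj] at hle
  have hterm : ∀ m ∈ Finset.range 200,
      (1 / ((m : ℝ) + 1) ^ 2 - 15 * ((m : ℝ) + 1) ^ 2 / x ^ 2) / 720 ≤ (f (g m)).re := by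
    intro m hm
    rw [Finset.mem_range] at hm
    have hm1 : (1 : ℝ) ≤ (m : ℝ) + 1 := by linarith [(m.cast_nonneg : (0:ℝ) ≤ m)]
    have hn0 : g m ≠ 0 := by simp [hg]
    have hncast : ((g m : ℕ) : ℝ) = ((m : ℝ) + 1) ^ 2 := by simp [hg]
    rw [hf]
    simp only
    rw [re_term_tripleMul_mul_hoffWeight h₁ h₂ h₃ hlink β hn0, hncast]
    set u : ℝ := ((m : ℝ) + 1) ^ 2 / x with hu
    have hu0 : 0 ≤ u := by positivity
    have hu1 : u ≤ 1 := by
      rw [hu, div_le_one hx0]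
      have : ((m : ℝ) + 1) ^ 2 ≤ 40000 := by
        have : (m : ℝ) + 1 ≤ 200 := by exact_mod_cast hm
        nlinarith
      linarith
    have hw : (1 - 15 * u ^ 2) / 720 ≤ (hoffWeight u).re := by
      rw [hoffWeight_of_le_one hu1, ofReal_re]
      exact div_le_div_of_nonneg_right (one_sub_le_hoffPoly hu0 hu1) (by norm_num)
    have hw0 : 0 ≤ (hoffWeight u).re := hoffWeight_re_nonneg hu0
    have hsq1 : (1 : ℝ) ≤ ((m : ℝ) + 1) ^ 2 := by nlinarith
    have hpow : 1 / ((m : ℝ) + 1) ^ 2 ≤ (((m : ℝ) + 1) ^ 2) ^ (-β) := by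
      rw [one_div, ← Real.rpow_neg_one]
      exact Real.rpow_le_rpow_of_exponent_le hsq1 (by linarith)
    have hpow0 : 0 ≤ (((m : ℝ) + 1) ^ 2) ^ (-β) := Real.rpow_nonneg (by positivity) _
    have hz := one_le_tripleMul_sq_re h₁ h₂ h₃ hlink (m := m + 1) (by omega)
    have hzcast : (tripleMul χ χ' ψ (g m)).re = (tripleMul χ χ' ψ ((m + 1) ^ 2)).re := by rw [hg]
    rw [hzcast]
    have e : (1 / ((m : ℝ) + 1) ^ 2 - 15 * ((m : ℝ) + 1) ^ 2 / x ^ 2) / 720 =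
        (1 / ((m : ℝ) + 1) ^ 2) * ((1 - 15 * u ^ 2) / 720) := by
      rw [hu]; field_simp
    rw [e]
    calc 1 / ((m : ℝ) + 1) ^ 2 * ((1 - 15 * u ^ 2) / 720)
        ≤ 1 / ((m : ℝ) + 1) ^ 2 * (hoffWeight u).re := by gcongr
      _ ≤ (((m : ℝ) + 1) ^ 2) ^ (-β) * (hoffWeight u).re := by gcongr
      _ = 1 * ((((m : ℝ) + 1) ^ 2) ^ (-β) * (hoffWeight u).re) := by ring
      _ ≤ (tripleMul χ χ' ψ ((m + 1) ^ 2)).re * ((((m : ℝ) + 1) ^ 2) ^ (-β) * (hoffWeight u).re) :=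
          mul_le_mul_of_nonneg_right hz (mul_nonneg hpow0 hw0)
      _ = _ := by ring
  have hsum := Finset.sum_le_sum hterm
  rw [← Finset.sum_div, div_le_iff₀ (by norm_num : (0:ℝ) < 720)] at hsum
  linarith

/-! ### Assembly: the three-character master inequality (11) -/

/-- The error constant `C₃(q, q′, k) = 720 · (q q′ k) ζ(3/2)⁴/(7 (2π)⁴)`, i.e. `6!/(2π) · 2π/7` times
the left-line constant `C_F`; the error term of the master inequality is `C₃ x^{−3/2}` (the source's
(7): `9!|(1/2πi)∫| ≤ .099/|D_K|^{A(3/2+β′)−2}`, line `Re(s+β′) = −3/2`).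
[cite: Hoffstein1980SiegelTatuzawa, §3 (7) p. 171] -/
def hoffErr3 (q q' k : ℕ) : ℝ := 720 * ((q : ℝ) * q' * k) * bigZ (3 / 2) ^ 4 / (7 * (2 * π) ^ 4)

omit [NeZero q'] [NeZero k] in
/-- For a quadratic non-trivial `χ`, `L(1, χ)` is real and positive. [folklore] -/
private lemma LFunction_one_real_pos (hχ1 : χ ≠ 1) (hq2 : χ ^ 2 = 1) :
    (χ.LFunction 1).im = 0 ∧ 0 < (χ.LFunction 1).re := by
  constructor
  · have := DirichletAbel.LFunction_ofReal_im_eq_zero χ hχ1 hq2 (σ := 1) one_pos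
    simpa using this
  · have := DirichletAbel.LFunction_ofReal_re_pos_of_forall_ne_zero χ hχ1 hq2 one_pos le_rfl
      fun σ h1 h2 ↦ by
        have hσ : σ = 1 := le_antisymm h2 h1
        subst hσ
        exact DirichletCharacter.LFunction_ne_zero_of_one_le_re χ (Or.inl hχ1) (by simp)
    simpa using this

set_option maxHeartbeats 400000 in
/-- **Hoffstein's master inequality for three characters** ((7), (9), (10) ⇒ (11), pp. 171–172): for
primitive quadratic `χ, χ′, ψ` modulo `q, q′, k > 1`, locally linked (`ψ` the primitive inducer of
`χχ′`), `½ < β < 1` with `F(β) = 0` (e.g. `L(β, χ′) = 0`), and `x ≥ 40000`,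
`(1 − β) · ( x^{−(1−β)} Σ_{m ≤ 200}(1/m² − 15m²/x²) − C₃(q,q′,k) x^{−3/2} ) ≤ L(1,χ) L(1,χ′) L(1,ψ)`
— the formal version of "`0.981(1 − β′) ≤ L(1,χ)L(1,χ′)L(1,χχ′)x^{1−β′}`".
[cite: Hoffstein1980SiegelTatuzawa, §3 (11) p. 172] -/
theorem hoffstein_master3 (hq : 1 < q) (hq' : 1 < q') (hk : 1 < k) (hχ : χ.IsPrimitive)
    (hχ' : χ'.IsPrimitive) (hψ : ψ.IsPrimitive) (h₁ : χ ^ 2 = 1) (h₂ : χ' ^ 2 = 1) (h₃ : ψ ^ 2 = 1)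
    (hlink : LocallyLinked χ χ' ψ) {β : ℝ} (hβ0 : 1 / 2 < β) (hβ1 : β < 1)
    (hFβ : hoffF χ χ' ψ β = 0) {x : ℝ} (hx : 40000 ≤ x) :
    (1 - β) * (x ^ (-(1 - β)) * ∑ m ∈ Finset.range 200, (1 / ((m : ℝ) + 1) ^ 2 - 15 * ((m : ℝ) + 1) ^ 2 / x ^ 2)
      - hoffErr3 q q' k * x ^ (-(3 / 2 : ℝ))) ≤
      (χ.LFunction 1).re * ((χ'.LFunction 1).re * (ψ.LFunction 1).re) := by
  have hx0 : 0 < x := by linarith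
  have hχ1 := ne_one_of_isPrimitive₃ hχ hq
  have hχ'1 := ne_one_of_isPrimitive₃ hχ' hq'
  have hψ1 := ne_one_of_isPrimitive₃ hψ hk
  have hκ : 0 < 1 - β := by linarith
  -- the identity (10) and the Perron formula
  have hId := hoffstein_contour_identity3 hq hq' hk hχ hχ' hψ hβ0 hβ1 hx0
  rw [integral_hoffG3_right_eq χ χ' ψ hβ1 hx0, hFβ, zero_div, add_zero] at hId
  set S : ℂ := ∑' n : ℕ, LSeries.term (tripleMul χ χ' ψ ·) β n * hoffWeight ((n : ℝ) / x) with hS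
  set Il : ℂ := ∫ y : ℝ, hoffG3 χ χ' ψ β x (↑(-1 / 2 - β) + y * I) with hIl
  -- the residue at `1 − β` is real: `L L L x^{1−β} κ`
  set kk : ℝ := 1 / ((1 - β) * (3 - β) * (4 - β) * (5 - β) * (6 - β) * (7 - β)) with hk'
  have hk0 : 0 < kk := by
    rw [hk']; apply one_div_pos.2
    apply mul_pos (mul_pos (mul_pos (mul_pos (mul_pos hκ _) _) _) _) <;> linarith
  have hKp : hoffKernel ((1 : ℂ) - β) = (kk : ℂ) := by
    unfold hoffKernel; rw [hk']; push_cast; ring_nf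
  have hxp : (x : ℂ) ^ ((1 : ℂ) - β) = ((x ^ (1 - β) : ℝ) : ℂ) := by
    rw [show (1 : ℂ) - β = ((1 - β : ℝ) : ℂ) by push_cast; ring, Complex.ofReal_cpow hx0.le]
  obtain ⟨hL1im, hL1pos⟩ := LFunction_one_real_pos hχ1 h₁
  obtain ⟨hL2im, hL2pos⟩ := LFunction_one_real_pos (χ := χ') hχ'1 h₂
  obtain ⟨hL3im, hL3pos⟩ := LFunction_one_real_pos (χ := ψ) hψ1 h₃
  set P : ℝ := (χ.LFunction 1).re * ((χ'.LFunction 1).re * (ψ.LFunction 1).re) with hP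
  have hPpos : 0 < P := by rw [hP]; exact mul_pos hL1pos (mul_pos hL2pos hL3pos)
  have hLLL : χ.LFunction 1 * (χ'.LFunction 1 * ψ.LFunction 1) = ((P : ℝ) : ℂ) := by
    have e1 : χ.LFunction 1 = (((χ.LFunction 1).re : ℝ) : ℂ) := by
      apply Complex.ext <;> simp [hL1im]
    have e2 : χ'.LFunction 1 = (((χ'.LFunction 1).re : ℝ) : ℂ) := by
      apply Complex.ext <;> simp [hL2im]
    have e3 : ψ.LFunction 1 = (((ψ.LFunction 1).re : ℝ) : ℂ) := by
      apply Complex.ext <;> simp [hL3im]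
    rw [e1, e2, e3, hP]; push_cast; ring
  have hRes1 : (χ.LFunction 1 * (χ'.LFunction 1 * ψ.LFunction 1) * (x : ℂ) ^ ((1 : ℂ) - β) *
      hoffKernel ((1 : ℂ) - β)).re = P * (x ^ (1 - β) * kk) := by
    rw [hLLL, hKp, hxp, ← ofReal_mul, ← ofReal_mul, ofReal_re]; ring
  -- the left integral
  have hIl : Il.re ≤ leftConst3 q q' k * x ^ (-1 / 2 - β) * (π / (7 / 2)) := by
    refine (Complex.re_le_norm _).trans ((norm_integral_le_integral_norm _).trans ?_)
    exact integral_norm_hoffG3_left_le hq hq' hk hχ hχ' hψ hβ0 hβ1 hx0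
  -- real part of the identity
  have hre := congrArg Complex.re hId
  rw [show (2 : ℂ) * π = ((2 * π : ℝ) : ℂ) by push_cast; ring] at hre
  simp only [Complex.sub_re, Complex.re_ofReal_mul] at hre
  rw [hRes1] at hre
  have hSq := squares_lower_bound3 h₁ h₂ h₃ hlink hβ1.le hx
  rw [← hS] at hSq
  have hπ := Real.pi_pos
  set Sm : ℝ := ∑ m ∈ Finset.range 200, (1 / ((m : ℝ) + 1) ^ 2 - 15 * ((m : ℝ) + 1) ^ 2 / x ^ 2) with hSm
  set Cl : ℝ := leftConst3 q q' k * x ^ (-1 / 2 - β) * (π / (7 / 2)) with hCl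
  -- `B := S.re − Cl/(2π)` and `P x^{1-β} kk ≥ B`
  have hB : S.re - Cl / (2 * π) ≤ P * (x ^ (1 - β) * kk) := by
    have : 2 * π * (S.re - Cl / (2 * π)) ≤ 2 * π * (P * (x ^ (1 - β) * kk)) := by
      have e : 2 * π * (S.re - Cl / (2 * π)) = 2 * π * S.re - Cl := by field_simp
      rw [e]
      nlinarith [hre, hIl]
    exact le_of_mul_le_mul_left this (by positivity)
  -- `x^{1-β} kk ≤ x^{1-β}/(720 (1-β))`
  have hxk : 0 < x ^ (1 - β) * kk := mul_pos (Real.rpow_pos_of_pos hx0 _) hk0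
  have hkle : x ^ (1 - β) * kk * (720 * (1 - β)) ≤ x ^ (1 - β) := by
    have hk'' : kk * (720 * (1 - β)) ≤ 1 := by
      rw [hk', one_div_mul_eq_div, div_le_one (by
        apply mul_pos (mul_pos (mul_pos (mul_pos (mul_pos hκ _) _) _) _) <;> linarith)]
      have h3 : (2 : ℝ) ≤ 3 - β := by linarith
      have h4 : (3 : ℝ) ≤ 4 - β := by linarith
      have h5 : (4 : ℝ) ≤ 5 - β := by linarith
      have h6 : (5 : ℝ) ≤ 6 - β := by linarith
      have h7 : (6 : ℝ) ≤ 7 - β := by linarith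
      calc 720 * (1 - β) = (1 - β) * 2 * 3 * 4 * 5 * 6 := by ring
        _ ≤ (1 - β) * (3 - β) * (4 - β) * (5 - β) * (6 - β) * (7 - β) := by gcongr
    nlinarith [Real.rpow_pos_of_pos hx0 (1 - β)]
  -- conclude
  have hxinv : x ^ (-(1 - β)) * x ^ (1 - β) = 1 := by
    rw [← Real.rpow_add hx0]; simp
  have hx32 : x ^ (-(1 - β)) * x ^ (-1 / 2 - β) = x ^ (-(3 / 2 : ℝ)) := by
    rw [← Real.rpow_add hx0]; congr 1; ring
  have hCE : x ^ (-(1 - β)) * (720 * (Cl / (2 * π))) = hoffErr3 q q' k * x ^ (-(3 / 2 : ℝ)) := by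
    rw [hCl, hoffErr3, leftConst3, ← hx32]
    field_simp
  have htarget : (1 - β) * (x ^ (-(1 - β)) * Sm - hoffErr3 q q' k * x ^ (-(3 / 2 : ℝ))) ≤
      (1 - β) * (x ^ (-(1 - β)) * (720 * (S.re - Cl / (2 * π)))) := by
    rw [← hCE]
    have hxκ : 0 < x ^ (-(1 - β)) := Real.rpow_pos_of_pos hx0 _
    nlinarith [hSq, mul_pos hκ hxκ]
  refine htarget.trans ?_
  rcases le_or_gt 0 (S.re - Cl / (2 * π)) with hpos | hneg
  · have h1 : (1 - β) * (x ^ (-(1 - β)) * (720 * (S.re - Cl / (2 * π)))) =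
        (x ^ (-(1 - β)) * (720 * (1 - β))) * (S.re - Cl / (2 * π)) := by ring
    rw [h1]
    calc x ^ (-(1 - β)) * (720 * (1 - β)) * (S.re - Cl / (2 * π))
        ≤ x ^ (-(1 - β)) * (720 * (1 - β)) * (P * (x ^ (1 - β) * kk)) := by gcongr
      _ = P * (x ^ (-(1 - β)) * (x ^ (1 - β) * kk * (720 * (1 - β)))) := by ring
      _ ≤ P * (x ^ (-(1 - β)) * x ^ (1 - β)) := by gcongr
      _ = P := by rw [hxinv, mul_one]
  · have hxκ : 0 < x ^ (-(1 - β)) := Real.rpow_pos_of_pos hx0 _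
    have h1 : x ^ (-(1 - β)) * (720 * (S.re - Cl / (2 * π))) < 0 :=
      mul_neg_of_pos_of_neg hxκ (by linarith)
    exact ((mul_neg_of_pos_of_neg hκ h1).le).trans hPpos.le

end Triple

end Literature.NumberTheory.LFunctions.Hoffstein1980

end
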